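import Summits.ResolutionOfSingularities.ResolutionOfSingularities.Theorems.HomologicalConductorNoZenoRMinimalOfDescent
import Summits.ResolutionOfSingularities.ResolutionOfSingularities.Theorems.HomologicalConductorNoZenoRBlowupRigidity
import Summits.ResolutionOfSingularities.ResolutionOfSingularities.Theorems.HomologicalConductorNoZenoRFirstKindStep
import HarnessLib

/-!
# Crux `NoZenoR` (stmt-ResolutionOfSingularities-19943) — the consumed form of Lipman (4.1) REDUCED to the numerical kernel
# (D2′): «a first-kind exceptional curve is not mapped ONTO a curve of a relatively minimal desingularization»

Route `ResolutionOfSingularities/HomologicalConductor` (cell decomp-res, hand leafhand-res-homologicalconduct-16 g3).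
OURS: AI-written bookkeeping over tree theorems, weaker than expert review; nothing here is a statement of the
manuscript under review (Hironaka 2017).  SUPPORT level, counted 0.  Def-free, no new named facts.

With the rigidity half (D1) of the one-blow-up descent proved (`exists_fac_of_forall_base_eq`, `…NoZenoRBlowupRigidity`),
the descent (D) of `…NoZenoRMinimalOfDescent` — and with it «`Spec S` has a minimal desingularization» for a rational
`S`, the consumed form `Lipman1969_4_1.exists_isMinimalResolution_Spec` of the W3 print `Lipman1969_4_1` — reduces to:

(D2′) for `S`-morphisms `h : W → X_r` of desingularizations of `Spec S` with `X_r` RELATIVELY MINIMAL (every `S`-morphism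
out of `X_r` to a desingularization is an isomorphism), the image of (the generic point of) an integral exceptional curve
of `W` OF THE FIRST KIND is a CLOSED point of `X_r`.

* `descent_of_firstKind_image` — (D2′) ⇒ (D) (the exceptional curve of the blow-up `τ : Z' → Z₁` is of the first kind,
  `exists_mem_excCurvePoints_blowup_point` + `PointBlowup.h0_comap_vanishingIdeal_point_sq_eq_three_mul`; its image is
  then a closed point, so `h` is constant on `τ⁻¹(z₁)` and (D1) applies);
* `exists_isMinimalResolution_of_firstKind_image` — **(D2′) ⇒ a rational `S` has a minimal desingularization**.

(D2′) is Lipman's p. 278 remark ((E·E)+χ(E) does not drop under proper transform) read on a relatively minimal surface; it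
is NOT proved here.  No crux or summit statement is proved here.
-/

noncomputable section

-- single-problem summit: the doubled namespace component `ResolutionOfSingularities` is forced
set_option linter.dupNamespace false

open CategoryTheory AlgebraicGeometry TopologicalSpace Topology IsLocalRing
open Literature.AlgebraicGeometry.Resolution Scheme.IdealSheafData

namespace Summit.ResolutionOfSingularities.ResolutionOfSingularities.Theorems.NoZeno.ExcCount.FirstKind

variable {S : Type} [CommRing S] [IsNoetherianRing S] [IsLocalRing S] [IsDomain S] [IsIntegrallyClosed S]

omit [IsIntegrallyClosed S] in
/-- **(D2′) ⇒ (D): the one-blow-up descent from the first-kind-image statement.**  For a desingularization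
`π_r : X_r → Spec S` (`S` a two-dimensional Noetherian local normal domain) such that every `S`-morphism `h : W → X_r`
from a desingularization maps first-kind exceptional curve points to CLOSED points, every `S`-morphism `Z' → X_r` from
the blowing up `τ : Z' → Z₁` of a closed point `z₁` (`dim 𝒪_{Z₁,z₁} = 2`) of a desingularization descends to `Z₁ → X_r`:
the exceptional curve `τ⁻¹(z₁) = cl{ε}` is of the first kind, so `h` is constant on it (`h(cl{ε}) ⊆ cl{h ε} = {h ε}`),
and the rigidity `exists_fac_of_forall_base_eq` applies. [cite: Lipman1969, Theorem (4.1) (p. 204); Corollary (27.3), proof (p. 278)] -/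
theorem descent_of_firstKind_image (h2 : ringKrullDim S = 2) {Xr : Scheme.{0}} {πr : Xr ⟶ Spec (.of S)}
    (hπr : IsResolution πr)
    (hD : ∀ (W : Scheme.{0}) (ψ : W ⟶ Spec (.of S)) (h : W ⟶ Xr), IsResolution ψ → h ≫ πr = ψ →
      ∀ ε ∈ excCurvePoints ψ, h0 ψ (primeDivisorIdeal ε ^ 2) = 3 * h0 ψ (primeDivisorIdeal ε) →
        IsClosed ({h.base ε} : Set Xr)) :
    ∀ (Z₁ Z' : Scheme.{0}) (g₁ : Z₁ ⟶ Spec (.of S)) (τ : Z' ⟶ Z₁) (z₁ : Z₁)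
      (hz₁ : IsClosed ({z₁} : Set Z₁)), IsResolution g₁ → ringKrullDim (Z₁.presheaf.stalk z₁) = 2 →
      IsBlowup τ (vanishingIdeal ⟨{z₁}, hz₁⟩) → ∀ h : Z' ⟶ Xr, h ≫ πr = τ ≫ g₁ →
        ∃ h₁ : Z₁ ⟶ Xr, τ ≫ h₁ = h ∧ h₁ ≫ πr = g₁ := by
  intro Z₁ Z' g₁ τ z₁ hz₁ hg₁ hz2 hτ h hh
  haveI : IsIntegral Z₁ := hg₁.isIntegral_source
  haveI : IsProper g₁ := hg₁.isProper
  haveI : IsLocallyNoetherian Z₁ := LocallyOfFiniteType.isLocallyNoetherian g₁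
  haveI : IsRegularLocalRing (Z₁.presheaf.stalk z₁) := hg₁.isRegular z₁
  have hbg : IsResolution (τ ≫ g₁) := isResolution_blowup_point_comp g₁ hg₁ hz₁ hz2 τ hτ
  haveI : IsIntegral Z' := hbg.isIntegral_source
  -- the exceptional curve of `τ` and its first-kind numerics
  obtain ⟨ε, hε, hcl, hId⟩ := exists_mem_excCurvePoints_blowup_point h2 g₁ hg₁ hz₁ hz2 τ hτ hbg
  have hnum : h0 (τ ≫ g₁) (primeDivisorIdeal ε ^ 2) = 3 * h0 (τ ≫ g₁) (primeDivisorIdeal ε) := by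
    rw [hId]
    exact PointBlowup.h0_comap_vanishingIdeal_point_sq_eq_three_mul g₁ τ z₁ hz₁ hz2 hτ
  -- its image is a closed point, so `h` is constant on the fibre
  have hclosed : IsClosed ({h.base ε} : Set Xr) := hD Z' (τ ≫ g₁) h hbg hh ε hε hnum
  have hcontr : ∀ e : Z', τ.base e = z₁ → h.base e = h.base ε := by
    intro e he
    have he' : e ∈ closure ({ε} : Set Z') := by rw [hcl]; exact he
    have hsp : h.base ε ⤳ h.base e := (specializes_iff_mem_closure.mpr he').map h.base.hom.continuous
    have hmem : h.base e ∈ closure ({h.base ε} : Set Xr) := specializes_iff_mem_closure.mp hsp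
    rw [hclosed.closure_eq] at hmem
    exact hmem
  exact exists_fac_of_forall_base_eq g₁ hg₁ τ hz₁ hz2 hτ πr hπr h hh hcontr

/-- **A rational surface singularity has a minimal desingularization, GRANTED (D2′)** «an `S`-morphism of desingularizations
does not map a first-kind exceptional curve onto a curve of a RELATIVELY MINIMAL desingularization» — the exact remaining
input of the consumed form `Lipman1969_4_1.exists_isMinimalResolution_Spec` of the W3 print `Lipman1969_4_1` for the crux
`NoZenoR`: `exists_isMinimalResolution_of_descent_of_hasRationalSingularity` (B) ✓, Zariski factorisation ✓, relatively
minimal models ✓) + `descent_of_firstKind_image` ((D1) rigidity ✓).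
[cite: Lipman1969, Theorem (4.1) (p. 204); Corollary (27.3), proof ¶1 (p. 277) and p. 278] -/
theorem exists_isMinimalResolution_of_firstKind_image (h2 : ringKrullDim S = 2) (hS : HasRationalSingularity S)
    (hD2 : ∀ (Xr : Scheme.{0}) (πr : Xr ⟶ Spec (.of S)), IsResolution πr →
      (∀ (X' : Scheme.{0}) (f' : X' ⟶ Spec (.of S)) (k' : Xr ⟶ X'), IsResolution f' → k' ≫ f' = πr → IsIso k') →
      ∀ (W : Scheme.{0}) (ψ : W ⟶ Spec (.of S)) (h : W ⟶ Xr), IsResolution ψ → h ≫ πr = ψ →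
        ∀ ε ∈ excCurvePoints ψ, h0 ψ (primeDivisorIdeal ε ^ 2) = 3 * h0 ψ (primeDivisorIdeal ε) →
          IsClosed ({h.base ε} : Set Xr)) :
    ∃ (X : Scheme.{0}) (f : X ⟶ Spec (.of S)), IsMinimalResolution f :=
  exists_isMinimalResolution_of_descent_of_hasRationalSingularity h2 hS fun Xr πr hπr hrel =>
    descent_of_firstKind_image h2 hπr (hD2 Xr πr hπr hrel)

end Summit.ResolutionOfSingularities.ResolutionOfSingularities.Theorems.NoZeno.ExcCount.FirstKind

end
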